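import Summits.Ventures.HodgeRepro2.T5LevelIdempotentDual
import Summits.Ventures.HodgeRepro2.T5SmoothDual

/-!
# The `K`-fixed vectors of `Hom_k(π, W)` are the finite-rank maps `Σ λ_i(·) w_i`, `λ_i ∈ (π̃)^K`

Kernel annex of the Tier-5 record (blind lane).  N3.L5(a) uses, for an admissible `π″_v`:
«the `H_v`-smooth vectors of `Hom_ℂ(π″_v, σ_v)` are `σ_v ⊗ (π″_v)^∨`» — here `H_v` acts on `π″_v`
alone.  In the language of the seat's files (`G` acting on `Hom_k(V, W)` through
`ρ.linHom (Representation.trivial k G W)`, i.e. `(g · f) = f ∘ ρ(g⁻¹)`; `e_K = levelAverage`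
of `T5LevelIdempotent`; `(V^*)^K ≅ (V^K)^*` of `T5LevelIdempotentDual`; `(π̃)^K = (V^*)^K` for
open `K` by `T5SmoothDual.smoothDualInvariants_eq`):

* `mem_invariants_linHom_trivial_iff` — `f` is `K`-fixed iff `f ∘ ρ(κ) = f` for all `κ ∈ K`;
* `smulRight_mem_invariants` — the rank-one maps `v ↦ λ(v) • w` with `λ ∈ (V^*)^K` are `K`-fixed;
* `apply_levelAverage_of_mem_invariants` — a `K`-fixed `f` satisfies `f (e_K v) = f v`, hence
  factors through `V^K`;
* `eq_sum_smulRight_of_mem_invariants` — with `V^K` finite-dimensional (admissibility at level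
  `K`) and a basis `(b_i)` of `V^K`: `f = Σ_i (b_i^* ∘ e_K)(·) • f(b_i)`, each `b_i^* ∘ e_K ∈ (V^*)^K`;
* `mem_invariants_linHom_trivial_iff_mem_span` — **the `K`-fixed vectors of `Hom_k(V, W)` are
  exactly the span of the rank-one maps `λ(·) • w`, `λ ∈ (V^*)^K`, `w ∈ W`** (= `(V^*)^K ⊗ W`), and
  `mem_invariants_linHom_trivial_iff_mem_span_smooth` — the same with `(π̃)^K` for open `K`.

What stays prose: that `σ_v` in the record is only a vector space for this step (the `H_v`-action
is on `π″_v`), that «smooth vector» = «fixed by some open compact `K`» (the union over `K` of the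
statement above), and the printed theorems.
-/

namespace Summit.Ventures.HodgeRepro2.T5HomInvariantsRankOne

open T5LevelIdempotent T5LevelIdempotentDual LevelPositivity

variable {G : Type*} [Group G] {k : Type*} [Field k]
  {V : Type*} [AddCommGroup V] [Module k V] {W : Type*} [AddCommGroup W] [Module k W]
  (ρ : Representation k G V) {K : Subgroup G}

/-- `f ∈ Hom_k(V, W)` is `K`-fixed for the action through `ρ` on `V` alone iff `f ∘ ρ(κ) = f` for
every `κ ∈ K`. -/
theorem mem_invariants_linHom_trivial_iff (f : V →ₗ[k] W) :
    f ∈ invariants (ρ.linHom (Representation.trivial k G W)) K ↔ ∀ κ ∈ K, f ∘ₗ ρ κ = f := by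
  rw [mem_invariants_iff]
  have key : ∀ g : G, (ρ.linHom (Representation.trivial k G W)) g f = f ∘ₗ ρ g⁻¹ := by
    intro g
    rw [Representation.linHom_apply]
    ext v
    simp only [LinearMap.comp_apply, Representation.trivial_apply]
  constructor
  · intro h κ hκ
    have := h κ⁻¹ (K.inv_mem hκ)
    rwa [key, inv_inv] at this
  · intro h g hg
    rw [key]
    exact h g⁻¹ (K.inv_mem hg)

/-- The rank-one map `v ↦ λ(v) • w` is `K`-fixed when `λ ∈ (V^*)^K`. -/
theorem smulRight_mem_invariants {l : Module.Dual k V} (hl : l ∈ invariants ρ.dual K) (w : W) :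
    l.smulRight w ∈ invariants (ρ.linHom (Representation.trivial k G W)) K := by
  rw [mem_invariants_linHom_trivial_iff]
  intro κ hκ
  ext v
  simp only [LinearMap.comp_apply, LinearMap.smulRight_apply]
  have h := LinearMap.congr_fun ((mem_invariants_dual_iff ρ).1 hl κ hκ) v
  rw [LinearMap.comp_apply] at h
  rw [h]

/-- The span of the rank-one maps `λ(·) • w`, `λ ∈ (V^*)^K`, consists of `K`-fixed vectors. -/
theorem span_smulRight_le_invariants :
    Submodule.span k {f : V →ₗ[k] W | ∃ l ∈ invariants ρ.dual K, ∃ w : W, f = l.smulRight w} ≤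
      invariants (ρ.linHom (Representation.trivial k G W)) K := by
  rw [Submodule.span_le]
  rintro _ ⟨l, hl, w, rfl⟩
  exact smulRight_mem_invariants ρ hl w

/-- A `K`-fixed `f : V → W` does not see the `K`-average: `f (e_K v) = f v`
(`e_K` = `levelAverage`, `[K : K_v] < ∞`, char `0`). -/
theorem apply_levelAverage_of_mem_invariants [CharZero k] {f : V →ₗ[k] W}
    (hf : f ∈ invariants (ρ.linHom (Representation.trivial k G W)) K) (v : V)
    [(stabilizerIn ρ K v).FiniteIndex] : f (levelAverage ρ K v) = f v := by
  rw [mem_invariants_linHom_trivial_iff] at hf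
  have hfin : Finite (K ⧸ stabilizerIn ρ K v) := Subgroup.finite_quotient_of_finiteIndex
  unfold levelAverage cosetSum
  rw [map_smul, map_finsum f (Set.toFinite _)]
  have : ∀ c : K ⧸ stabilizerIn ρ K v, f (ρ ((Quotient.out c : K) : G) v) = f v := fun c => by
    have := LinearMap.congr_fun (hf _ (Quotient.out c).2) v
    simpa only [LinearMap.comp_apply] using this
  simp only [this]
  haveI := Fintype.ofFinite (K ⧸ stabilizerIn ρ K v)
  rw [finsum_eq_sum_of_fintype, Finset.sum_const, Finset.card_univ, ← Nat.card_eq_fintype_card,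
    ← Subgroup.index_eq_card, ← Nat.cast_smul_eq_nsmul k, smul_smul, inv_mul_cancel₀, one_smul]
  exact_mod_cast Subgroup.FiniteIndex.index_ne_zero

/-- A `K`-fixed `f` factors through `e_K : V → V^K` (`levelIdempotentTo` of
`T5LevelIdempotentDual`): `f v = f (e_K v)`. -/
theorem apply_eq_apply_levelIdempotentTo [CharZero k] (hK : KFinite ρ K) {f : V →ₗ[k] W}
    (hf : f ∈ invariants (ρ.linHom (Representation.trivial k G W)) K) (v : V) :
    f v = f (levelIdempotentTo ρ hK v : V) := by
  haveI := hK v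
  rw [levelIdempotentTo_apply, apply_levelAverage_of_mem_invariants ρ hf v]

/-- **The finite-rank expansion.**  With `V^K` finite-dimensional and `(b_i)` a basis of `V^K`,
a `K`-fixed `f : V → W` is `f = Σ_i (b_i^* ∘ e_K)(·) • f(b_i)`, where `b_i^* ∘ e_K = extendDual
(b.coord i) ∈ (V^*)^K`. -/
theorem eq_sum_smulRight_of_mem_invariants [CharZero k] (hK : KFinite ρ K) {ι : Type*} [Fintype ι]
    (b : Module.Basis ι k (invariants ρ K)) {f : V →ₗ[k] W}
    (hf : f ∈ invariants (ρ.linHom (Representation.trivial k G W)) K) :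
    f = ∑ i, (extendDual ρ hK (b.coord i) : Module.Dual k V).smulRight (f (b i : V)) := by
  ext v
  rw [LinearMap.sum_apply]
  simp only [LinearMap.smulRight_apply, extendDual_apply, Module.Basis.coord_apply]
  conv_lhs => rw [apply_eq_apply_levelIdempotentTo ρ hK hf v,
    ← b.sum_repr (levelIdempotentTo ρ hK v)]
  rw [Submodule.coe_sum, map_sum]
  simp only [Submodule.coe_smul, map_smul]

/-- **The `K`-fixed vectors of `Hom_k(V, W)` are `(V^*)^K ⊗ W`** (admissible at level `K`:
`V^K` finite-dimensional; `ρ` `K`-finite; char `0`): `f` is `K`-fixed iff it is a finite sum of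
rank-one maps `λ(·) • w` with `λ ∈ (V^*)^K`. -/
theorem mem_invariants_linHom_trivial_iff_mem_span [CharZero k] (hK : KFinite ρ K)
    [FiniteDimensional k (invariants ρ K)] (f : V →ₗ[k] W) :
    f ∈ invariants (ρ.linHom (Representation.trivial k G W)) K ↔
      f ∈ Submodule.span k
        {g : V →ₗ[k] W | ∃ l ∈ invariants ρ.dual K, ∃ w : W, g = l.smulRight w} := by
  constructor
  · intro hf
    rw [eq_sum_smulRight_of_mem_invariants ρ hK (Module.finBasis k (invariants ρ K)) hf]
    refine Submodule.sum_mem _ fun i _ => Submodule.subset_span ?_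
    exact ⟨_, (extendDual ρ hK ((Module.finBasis k (invariants ρ K)).coord i)).2, _, rfl⟩
  · intro hf
    exact span_smulRight_le_invariants ρ hf

/-- The same statement with the `K`-fixed vectors of the SMOOTH dual `(π̃)^K`
(`T5SmoothDual.smoothDualInvariants`), for `K` open in a topological group `G`:
«the `K`-fixed vectors of `Hom_k(π, W)` are `(π̃)^K ⊗ W`». -/
theorem mem_invariants_linHom_trivial_iff_mem_span_smooth [TopologicalSpace G]
    [IsTopologicalGroup G] [CharZero k] (hK : KFinite ρ K) (hopen : IsOpen (K : Set G))
    [FiniteDimensional k (invariants ρ K)] (f : V →ₗ[k] W) :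
    f ∈ invariants (ρ.linHom (Representation.trivial k G W)) K ↔
      f ∈ Submodule.span k
        {g : V →ₗ[k] W | ∃ l ∈ T5SmoothDual.smoothDualInvariants ρ K, ∃ w : W, g = l.smulRight w} := by
  rw [T5SmoothDual.smoothDualInvariants_eq ρ hopen]
  exact mem_invariants_linHom_trivial_iff_mem_span ρ hK f

end Summit.Ventures.HodgeRepro2.T5HomInvariantsRankOne
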